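import Literature.MathematicalPhysics.QuantumFieldTheory.Balaban1983to89.B16NodeKnit
import Literature.MathematicalPhysics.QuantumFieldTheory.Balaban1983to89.B14NodeKnit
import Literature.MathematicalPhysics.QuantumFieldTheory.Balaban1983to89.B10Eq2DensityTower

/-!
# YM-DAG node N13 · [Balaban1989LargeFieldII] — NON-VACUITY of the contract module: the hypotheses of
# `B16NodeKnitContract.endStatementBPrinted_of_slots` (the (B) pin from the displayed slots of the N11 and N13 knits) and of
# `nodes_N11_N13_of_slots` are JOINTLY SATISFIABLE — type-level sanity for the referee's vacuity audit (A2 ∕ A5)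

TRACK-A SEAT FILE (seat `pub-ymgap-dag-n13-a`; companion of `B16NodeKnit` p409035 and `B16NodeKnitContract` p409383 — the latter is NOT imported: its
theorems' hypothesis lists are restated VERBATIM below and witnessed, and the conclusions are re-derived by name from `B16NodeKnit` ∕ `B14NodeKnit` ∕
`DagBinding`, so that this file elaborates independently of that module's build).  THEOREMS ONLY.  The witnesses are
DEGENERATE and live inside the proofs: one-configuration construction with `ρ ≡ 1`, `χ ≡ 1`, `A ≡ 0`, one site, constant coupling `g ≡ 1`,
`β ≡ 0`, all clause fields `True`; exponent functions `e± ≡ 0`; the all-`True` upstream block; 𝐑-carriers on the gauge group `U(1)` with the identity as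
𝐑 and `S = Scorr = True`; the (0.2) trajectory `B10Eq2DensityTower.towerStd` (the standard averaging family of `AveragingRT` with its integrable-density
renormalization transformations, Wilson start, identity 𝐑 — [Balaban1985UV3] (1)–(2) on the carrier of record); the one-term (2.18) representation.
NOTHING here is an object of record and nothing of Bałaban's is asserted: the point is only that the seventeen displayed hypotheses of the pin theorem do
not contradict each other (so the theorem is not vacuously true), exactly as `Node00.Satisfiable` does for the staged world predicates.
One finite T⁴ programme at fixed ε; NOT ℝ⁴ ∕ infinite volume ∕ OS ∕ mass gap ∕ Clay.
-/

noncomputable section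

namespace Literature.MathematicalPhysics.QuantumFieldTheory.Balaban1983to89.B16NodeKnitNonVacuity

open DagBinding DagDischargedII

/-- The flow inequality (2.6) of [Balaban1988Convergent] holds for a CONSTANT coupling sequence `g ≡ 1` with `β′ = β₀ = 1` (degenerate check used by
the witness below: `1 ≤ √(1 + (n − m))` and `1 ≤ 2`). [cite: Balaban1988Convergent, (2.6) p.255 (bookkeeping: a degenerate instance)] -/
theorem flowIneq26_const_one (K : ℕ) : B14.FlowIneq26 (fun _ => (1 : ℝ)) 1 1 K := by
  intro m n hmn _
  have hnm : (1 : ℝ) ≤ (n : ℝ) - m := by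
    have : (m : ℝ) + 1 ≤ n := by exact_mod_cast hmn
    linarith
  refine ⟨?_, by norm_num⟩
  rw [mul_one, one_pow, one_mul, one_mul]
  exact Real.one_le_sqrt.mpr (by linarith)

/-- **The hypotheses of `B16NodeKnitContract.endStatementBPrinted_of_slots` are JOINTLY SATISFIABLE** — there are a binding world `w` with `0 < w.γ`,
per-run 𝐑-carriers `V`, averaging operations, (0.2) trajectories `D` and a (2.18) family `R` satisfying ALL of: the trajectory pins (`P.K ≤ (V P).K`,
`D.R = V.R`), the dictionary `V.S k (ρ_k) → Sect2Form k`, the start, N11's T-slot with its antecedents, N13's R-slot `ROpLeaf (V P)`, the five Cor-3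
leaves, the in-edge leaves `b7 … b11`, the small-field leaf and the located flow step — together with the pin `B16.EndStatementBPrinted w.C` at the
witness (re-derived here along that theorem's proof: `B14.inductiveAssumptions_of_thmP245I` + `B14NodeKnit.rAssumed_of_rOpLeaf` + `B16NodeKnit.uvSlot_of_cor3Leaves`
+ `DagBinding.endStatementBPrinted_of_worldsP`).  DEGENERATE witness (module docstring); count-neutral. [cite: Balaban1989LargeFieldII, Thm 1 p.355 + p.391 (bookkeeping: satisfiability of the slot list); Balaban1985UV3, (1)–(2) p.256 (the standard trajectory)] -/
theorem endStatementBPrinted_of_slots_nonvacuous :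
    ∃ (w : WorldP) (V : B12.RunParams → PrintedCarriers14R) (av : (P : B12.RunParams) → ∀ j, Averaging (V P).P j (V P).G)
      (D : (P : B12.RunParams) → Step.DensityRGI (V P).P (V P).G (av P)) (R : B14Cor3.ReprFamily w.C),
      0 < w.γ ∧ (∀ P, P.K ≤ (V P).K) ∧ (∀ P k ρ, (D P).R k ρ = (V P).R k ρ) ∧
      (∀ P k, k ≤ P.K → (V P).S k ((D P).ρ k) → (w.C P).Sect2Form k) ∧
      (∀ P, (leavesP w P).smallCouplings → (V P).S 0 ((D P).ρ 0)) ∧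
      (∀ P, (leavesP w P).b7 → (leavesP w P).b8 → (leavesP w P).b9 → (leavesP w P).b10 → (leavesP w P).b11 →
        (leavesP w P).smallCouplings → (leavesP w P).smallFieldInductive → (leavesP w P).flowControl →
          B14.ThmP245PrintedI (D P).T (D P).ρ (V P).S (V P).Scorr P.K) ∧
      (∀ P, ROpLeaf (V P)) ∧
      B14Cor3.LeafH w.C R w.γ ∧ B14Cor3.LeafU1 w.C R w.γ ∧ B14Cor3.LeafU2 w.C R w.γ w.ep ∧
      B14Cor3.LeafL1 w.C R w.γ ∧ B14Cor3.LeafL2 w.C R w.γ w.em ∧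
      (∀ P, (leavesP w P).b7 ∧ (leavesP w P).b8 ∧ (leavesP w P).b9 ∧ (leavesP w P).b10 ∧ (leavesP w P).b11) ∧
      (∀ P, (leavesP w P).smallCouplings → (leavesP w P).smallFieldInductive) ∧
      (∀ P, Dag.FlowStepPrinted (leavesP w P)) ∧
      B16.EndStatementBPrinted w.C := by
  obtain ⟨P₀⟩ := Node00.nonempty_params
  let G : Type := ↥(Matrix.unitaryGroup (Fin 1) ℂ)
  let w : WorldP :=
    { C := fun _ =>
        { flow := { g := fun _ => 1, β := fun _ _ => 0 }, Cfg := fun _ => PUnit, dom := fun _ => Set.univ, effAction := fun _ _ => 0,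
          wilsonBG := fun _ _ => 0, Ek := fun _ _ => 0, numSites := fun _ => 1, Repr := fun _ => True, IndAss := fun _ => True,
          ρ := fun _ _ => 1, χ := fun _ _ => 1, Sect2Form := fun _ => True },
      γ := 1, em := fun _ => 0, ep := fun _ => 0, βup := 1, β₀ := 1, β₀_pos := one_pos, b := 1, b_pos := one_pos, L := 2,
      one_lt_L := one_lt_two, gR := 1,
      up := fun _ => { b4 := True, b5 := True, b6 := True, b7 := True, b8 := True, b9 := True, b10 := True, b11 := True, b12 := True,
                       b13 := True, rOperation := True, rBasicStep := True } }
  let V : B12.RunParams → PrintedCarriers14R := fun P =>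
    { P := P₀, G := G, instGG := inferInstance, instMS := inferInstance, instHD := inferInstance,
      K := P.K, R := fun _ ρ => ρ, Scorr := fun _ _ => True, S := fun _ _ => True }
  let av : (P : B12.RunParams) → ∀ j, Averaging (V P).P j (V P).G := fun _ => AveragingRT.stdAvg P₀ G
  let D : (P : B12.RunParams) → Step.DensityRGI (V P).P (V P).G (av P) := fun _ => B10Eq2DensityTower.towerStd P₀ G 1 0
  let R : B14Cor3.ReprFamily w.C := fun _ _ => { Adm := Unit, term := fun _ _ => 1, major := fun _ => 1, allSmall := () }
  have hγ : 0 < w.γ := one_pos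
  have hK : ∀ P : B12.RunParams, P.K ≤ (V P).K := fun _ => le_rfl
  have hRR : ∀ (P : B12.RunParams) k ρ, (D P).R k ρ = (V P).R k ρ := fun _ _ _ => rfl
  have hS : ∀ (P : B12.RunParams) k, k ≤ P.K → (V P).S k ((D P).ρ k) → (w.C P).Sect2Form k := fun _ _ _ _ => trivial
  have h0 : ∀ P : B12.RunParams, (leavesP w P).smallCouplings → (V P).S 0 ((D P).ρ 0) := fun _ _ => trivial
  have hT : ∀ P : B12.RunParams, (leavesP w P).b7 → (leavesP w P).b8 → (leavesP w P).b9 → (leavesP w P).b10 → (leavesP w P).b11 →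
      (leavesP w P).smallCouplings → (leavesP w P).smallFieldInductive → (leavesP w P).flowControl →
        B14.ThmP245PrintedI (D P).T (D P).ρ (V P).S (V P).Scorr P.K := fun _ _ _ _ _ _ _ _ _ _ _ _ => trivial
  have hR : ∀ P : B12.RunParams, ROpLeaf (V P) := fun _ _ _ _ _ => trivial
  have hH : B14Cor3.LeafH w.C R w.γ := by
    intro P _ k _ _ U
    show (1 : ℝ) = ∑ _a : Unit, (1 : ℝ)
    simp
  have hU1 : B14Cor3.LeafU1 w.C R w.γ := fun _ _ _ _ _ _ _ => le_rfl
  have hU2 : B14Cor3.LeafU2 w.C R w.γ w.ep := by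
    intro P _ k _ _
    show ∑ _a : Unit, (1 : ℝ) ≤ Real.exp (0 * ((1 : ℕ) : ℝ))
    simp
  have hL1 : B14Cor3.LeafL1 w.C R w.γ := fun _ _ _ _ _ _ _ => zero_le_one
  have hL2 : B14Cor3.LeafL2 w.C R w.γ w.em := by
    intro P _ k _ _ U
    show (1 : ℝ) * Real.exp (-(1 / (1 : ℝ) ^ 2 * 0) - 0 * ((1 : ℕ) : ℝ)) ≤ 1
    norm_num
  have hin : ∀ P : B12.RunParams, (leavesP w P).b7 ∧ (leavesP w P).b8 ∧ (leavesP w P).b9 ∧ (leavesP w P).b10 ∧ (leavesP w P).b11 :=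
    fun _ => ⟨trivial, trivial, trivial, trivial, trivial⟩
  have hsf : ∀ P : B12.RunParams, (leavesP w P).smallCouplings → (leavesP w P).smallFieldInductive := fun _ _ _ _ => trivial
  have hflow : ∀ P : B12.RunParams, Dag.FlowStepPrinted (leavesP w P) := fun P _ => flowIneq26_const_one P.K
  have hpin : B16.EndStatementBPrinted w.C := by
    refine endStatementBPrinted_of_worldsP w hγ fun P hsc => ?_
    obtain ⟨h7, h8, h9, h10, h11⟩ := hin P
    have hdd : ∀ k, k ≤ P.K → (w.C P).Sect2Form k := fun k hk =>
      hS P k hk (B14.inductiveAssumptions_of_thmP245I (D P) (h0 P hsc) (hT P h7 h8 h9 h10 h11 hsc (hsf P hsc) (hflow P hsc))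
        (B14NodeKnit.rAssumed_of_rOpLeaf (V P) (D P) (hK P) (hRR P) (hR P)) k hk)
    exact ⟨hdd, B16NodeKnit.uvSlot_of_cor3Leaves w R hH hU1 hU2 hL1 hL2 P (fun _ => hdd) hsc⟩
  exact ⟨w, V, av, D, R, hγ, hK, hRR, hS, h0, hT, hR, hH, hU1, hU2, hL1, hL2, hin, hsf, hflow, hpin⟩

/-- **The hypotheses of `B16NodeKnitContract.nodes_N11_N13_of_slots` are jointly satisfiable at a run BOUND TO THE N-BINDING** (so that theorem, too, is
not vacuous): a world whose upstream block at every run is `Upstream.ofPrintedAllXPN X Y Z V W` over degenerate bundles with the 𝐑-carrier `V` above, at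
which N11 and N13 hold at every run (re-derived by name: `B14NodeKnit.b14_main_ofPrintedAllXPN_of_thmP245I`, `B16NodeKnit.b16_main_of_rOp_of_uv`). [cite: Balaban1989LargeFieldII, Thm 1 p.355; Balaban1988Convergent, Thm 1 p.262 (bookkeeping: satisfiability)] -/
theorem nodes_N11_N13_of_slots_nonvacuous :
    ∃ (w : WorldP) (V : PrintedCarriers14R) (X : PrintedCarriersR) (Y : PrintedCarriers9X) (Z : PrintedCarriers11) (W : PrintedCarriers15),
      (∀ P : B12.RunParams, w.up P = Upstream.ofPrintedAllXPN X Y Z V W) ∧ ROpLeaf V ∧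
      ∀ P : B12.RunParams, P.K ≤ V.K → Dag.B14_main (leavesP w P) ∧ Dag.B16_main (leavesP w P) := by
  obtain ⟨P₀⟩ := Node00.nonempty_params
  obtain ⟨X⟩ := Node00.nonempty_printedCarriersR; obtain ⟨Y⟩ := Node00.nonempty_printedCarriers9X
  obtain ⟨Z⟩ := Node00.nonempty_printedCarriers11; obtain ⟨W⟩ := Node00.nonempty_printedCarriers15
  let G : Type := ↥(Matrix.unitaryGroup (Fin 1) ℂ)
  let V : PrintedCarriers14R :=
    { P := P₀, G := G, instGG := inferInstance, instMS := inferInstance, instHD := inferInstance,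
      K := 0, R := fun _ ρ => ρ, Scorr := fun _ _ => True, S := fun _ _ => True }
  let w : WorldP :=
    { C := fun _ =>
        { flow := { g := fun _ => 1, β := fun _ _ => 0 }, Cfg := fun _ => PUnit, dom := fun _ => Set.univ, effAction := fun _ _ => 0,
          wilsonBG := fun _ _ => 0, Ek := fun _ _ => 0, numSites := fun _ => 1, Repr := fun _ => True, IndAss := fun _ => True,
          ρ := fun _ _ => 1, χ := fun _ _ => 1, Sect2Form := fun _ => True },
      γ := 1, em := fun _ => 0, ep := fun _ => 0, βup := 1, β₀ := 1, β₀_pos := one_pos, b := 1, b_pos := one_pos, L := 2,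
      one_lt_L := one_lt_two, gR := 1,
      up := fun _ => Upstream.ofPrintedAllXPN X Y Z V W }
  have hR : ROpLeaf V := fun _ _ _ _ => trivial
  refine ⟨w, V, X, Y, Z, W, fun _ => rfl, hR, fun P hK => ?_⟩
  let D : Step.DensityRGI V.P V.G (AveragingRT.stdAvg P₀ G) := B10Eq2DensityTower.towerStd P₀ G 1 0
  have huv : ((w.C P).flow.InInterval w.γ P.K → ∀ k, k ≤ P.K → (w.C P).Sect2Form k) →
      (w.C P).flow.InInterval w.γ P.K → ∀ k, k ≤ P.K → ∀ U : (w.C P).Cfg k,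
        B16.UVIneq (w.C P) k U (w.em ((w.C P).flow.g k)) (w.ep ((w.C P).flow.g k)) := by
    intro _ _ k _ U
    show (1 : ℝ) * Real.exp (-(1 / (1 : ℝ) ^ 2 * 0) - 0 * ((1 : ℕ) : ℝ)) ≤ 1 ∧ (1 : ℝ) ≤ Real.exp (0 * ((1 : ℕ) : ℝ))
    norm_num
  exact ⟨B14NodeKnit.b14_main_ofPrintedAllXPN_of_thmP245I w P V X Y Z W rfl D hK (fun _ _ => rfl) (fun _ _ _ => trivial)
      (fun _ => trivial) (fun _ _ _ _ _ _ _ _ _ _ _ => trivial),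
    B16NodeKnit.b16_main_of_rOp_of_uv (w := w) (P := P) rfl hR huv⟩

end Literature.MathematicalPhysics.QuantumFieldTheory.Balaban1983to89.B16NodeKnitNonVacuity

end
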